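import Mathlib
import HarnessLib
import Literature.Analysis.FluidPDE.LocalTypeIBlowup.SingularVertexZoom

/-!
# Line `scar_zoom` on crux `TypeIQuarterGate.ScarEnvelopeTypeI` (stmt-NavierStokesRegularity-23843) —
# tools for STUB B `stub_scarZoom`, file 1: persistence of singularities at a TRANSLATED vertex

Helper file (no new definitions) for the twin-scar zoom of STUB B.  The tree's compactness engine
`LocalTypeIBlowup.local_typeI_compactness_singular` (Albritton–Barker 2019 §3 + Prop. 2.3 =
Rusin–Šverák 2011 Lemma 2.1, Barker–Prange 2020 Lemma 3) exports persistence of singularities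
only AT THE ORIGIN of the zoomed picture.  The twin-scar object needs persistence at a second
point `(0, e)`, `‖e‖ = 1`.  Here we prove the translated step once and for all:

* `isBackwardSingularPoint_of_translated_persistence` — given the level data of the engine
  (suitable weak solutions `(v_k, q_k)` in the balls `Q(0, 2ᵐ)`, `m ≤ k`, with uniform
  `L³ × L^{3/2}` bounds at every level, and a limit `(u, p)` along `σ` with the convergences of
  `LocalTypeIBlowup.local_suitableCompactness`: class on every `Q(0, a)`, strong `L³`, weak
  pressure convergence), if the approximants blow up in `L^∞(Q(z, R))` along `σ` for every
  `0 < R < 1` at a point `z` of the closed backward slab (`z.1 ≤ 0`), then `z` is a backward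
  singular point of `u`.  Proof: translate everything by `z` (the unit-scale space–time shift
  `stAffine 1 1 z.1 z.2`), check the hypotheses of the tree's PROVED
  `PersistenceOfSingularities_holds` (A–B Prop. 2.3) on `Q(0, 1)` — class by
  `of_subset_zero` + `zoom`/`zoomOut`, norms and pairings by the change of variables
  (`eLpNorm_comp_stAffine_preimage`, `setIntegral_preimage_comp_stAffine`, Jacobian `1`) — and
  translate the conclusion back (`eLpNorm_top_nsZoom`).

Bookkeeping only; no statement about the crux, its parent or the summit is proved here.
-/

noncomputable section

-- the summit-side namespace `Summit.NavierStokesRegularity.NavierStokesRegularity.…` (single-conjunct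
-- summit, D-0017) repeats a component by design; the dupNamespace linter would flag every declaration.
set_option linter.dupNamespace false

namespace Summit.NavierStokesRegularity.NavierStokesRegularity.Cruxes.ScarEnvelopeTypeI.ScarZoom

open MeasureTheory Set Function Filter Topology TopologicalSpace Metric
open scoped NNReal ENNReal
open Literature.Analysis Literature.Analysis.FluidPDE

/-! ### The unit-scale space–time translation `stAffine 1 1 t₀ x₀` -/

/-- Preimage of a parabolic cylinder under the unit-scale translation by `(t₀, x₀)`:
`τ⁻¹ Q(c, ρ) = Q((c.1 − t₀, c.2 − x₀), ρ)`. -/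
theorem stAffine_one_one_preimage_parabolicCylinder (t₀ : ℝ) (x₀ : (EuclideanSpace ℝ (Fin 3))) (c : ℝ × (EuclideanSpace ℝ (Fin 3))) (ρ : ℝ) :
    stAffine (1 : ℝ) 1 t₀ x₀ ⁻¹' parabolicCylinder ρ c =
      parabolicCylinder ρ ((c.1 - t₀, c.2 - x₀) : ℝ × (EuclideanSpace ℝ (Fin 3))) := by
  ext ⟨s, y⟩
  rw [mem_preimage, stAffine_apply, mem_parabolicCylinder, mem_parabolicCylinder, one_mul, one_smul]
  simp only [dist_eq_norm]
  rw [show x₀ + y - c.2 = y - (c.2 - x₀) by abel]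
  constructor
  · rintro ⟨⟨h1, h2⟩, h3⟩
    exact ⟨⟨by linarith, by linarith⟩, h3⟩
  · rintro ⟨⟨h1, h2⟩, h3⟩
    exact ⟨⟨by linarith, by linarith⟩, h3⟩

/-- In particular `τ_z⁻¹ Q(z, ρ) = Q(0, ρ)` for the translation by `z`. -/
theorem stAffine_one_one_preimage_parabolicCylinder_self (z : ℝ × (EuclideanSpace ℝ (Fin 3))) (ρ : ℝ) :
    stAffine (1 : ℝ) 1 z.1 z.2 ⁻¹' parabolicCylinder ρ z = parabolicCylinder ρ (0 : ℝ × (EuclideanSpace ℝ (Fin 3))) := by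
  rw [stAffine_one_one_preimage_parabolicCylinder, sub_self, sub_self]
  rfl

/-- … and `τ_{−z}⁻¹ Q(0, ρ) = Q(z, ρ)` for the translation by `−z`. -/
theorem stAffine_one_one_neg_preimage_parabolicCylinder (z : ℝ × (EuclideanSpace ℝ (Fin 3))) (ρ : ℝ) :
    stAffine (1 : ℝ) 1 (-z.1) (-z.2) ⁻¹' parabolicCylinder ρ (0 : ℝ × (EuclideanSpace ℝ (Fin 3))) = parabolicCylinder ρ z := by
  rw [stAffine_one_one_preimage_parabolicCylinder]
  simp only [Prod.fst_zero, Prod.snd_zero, zero_sub, neg_neg]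

/-- `τ_{−z} ∘ τ_z = id`. -/
theorem stAffine_one_one_neg_apply (z : ℝ × (EuclideanSpace ℝ (Fin 3))) (w : ℝ × (EuclideanSpace ℝ (Fin 3))) :
    stAffine (1 : ℝ) 1 (-z.1) (-z.2) (stAffine (1 : ℝ) 1 z.1 z.2 w) = w := by
  obtain ⟨s, y⟩ := w
  rw [stAffine_apply, stAffine_apply, one_mul, one_smul, one_mul, one_smul]
  ext <;> simp

/-- `L^q` norms (finite `q`) are invariant under the unit-scale translation:
`‖g ∘ τ_z‖_{L^q(Q(0,ρ))} = ‖g‖_{L^q(Q(z,ρ))}`. -/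
theorem eLpNorm_comp_translate {G : Type*} [NormedAddCommGroup G] (z : ℝ × (EuclideanSpace ℝ (Fin 3))) (ρ : ℝ)
    (g : ℝ × (EuclideanSpace ℝ (Fin 3)) → G) {q : ℝ≥0∞} (hq0 : q ≠ 0) (hqtop : q ≠ ∞) :
    eLpNorm (g ∘ stAffine (1 : ℝ) 1 z.1 z.2) q (volume.restrict (parabolicCylinder ρ (0 : ℝ × (EuclideanSpace ℝ (Fin 3))))) =
      eLpNorm g q (volume.restrict (parabolicCylinder ρ z)) := by
  rw [← stAffine_one_one_preimage_parabolicCylinder_self z ρ,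
    eLpNorm_comp_stAffine_preimage one_pos one_pos z.1 z.2 g _ hq0 hqtop]
  simp

/-- `L^∞` norms of a translated velocity: `‖τ_z^* f‖_{L^∞(Q(0,r))} = ‖f‖_{L^∞(Q(z,r))}`. -/
theorem eLpNorm_top_translate (z : ℝ × (EuclideanSpace ℝ (Fin 3))) (r : ℝ) (f : ℝ → (EuclideanSpace ℝ (Fin 3)) → (EuclideanSpace ℝ (Fin 3))) :
    eLpNorm (uncurry (stPull (1 : ℝ) 1 z.1 z.2 f)) ⊤
        (volume.restrict (parabolicCylinder r (0 : ℝ × (EuclideanSpace ℝ (Fin 3))))) =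
      eLpNorm (uncurry f) ⊤ (volume.restrict (parabolicCylinder r z)) := by
  have h := eLpNorm_top_nsZoom (c := (1 : ℝ)) one_pos z.1 z.2 r (0 : ℝ × (EuclideanSpace ℝ (Fin 3))) f
  have e : stAffine ((1 : ℝ) ^ 2) 1 z.1 z.2 (0 : ℝ × (EuclideanSpace ℝ (Fin 3))) = z := by
    rw [show (0 : ℝ × (EuclideanSpace ℝ (Fin 3))) = ((0 : ℝ), (0 : (EuclideanSpace ℝ (Fin 3)))) from rfl, stAffine_apply, mul_zero, add_zero,
      smul_zero, add_zero]
  rw [e, one_pow, one_smul, one_mul, ENNReal.ofReal_one, one_mul] at h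
  exact h

/-- `L^q` classes are transported by the unit-scale translation:
`g ∈ L^q(Q(c, ρ))` gives `g ∘ τ ∈ L^q(τ⁻¹ Q(c, ρ))`. -/
theorem memLp_comp_translate {G : Type*} [NormedAddCommGroup G] (t₀ : ℝ) (x₀ : (EuclideanSpace ℝ (Fin 3)))
    {g : ℝ × (EuclideanSpace ℝ (Fin 3)) → G} {S : Set (ℝ × (EuclideanSpace ℝ (Fin 3)))} {q : ℝ≥0∞} (hq0 : q ≠ 0) (hqtop : q ≠ ∞)
    (hg : MemLp g q (volume.restrict S)) :
    MemLp (g ∘ stAffine (1 : ℝ) 1 t₀ x₀) q (volume.restrict (stAffine (1 : ℝ) 1 t₀ x₀ ⁻¹' S)) := by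
  refine ⟨?_, ?_⟩
  · refine hg.1.comp_quasiMeasurePreserving ⟨measurable_stAffine _ _ _ _, ?_⟩
    rw [map_stAffine_volume_restrict_preimage one_pos one_pos]
    exact Measure.smul_absolutelyContinuous
  · rw [eLpNorm_comp_stAffine_preimage one_pos one_pos t₀ x₀ g _ hq0 hqtop]
    exact ENNReal.mul_lt_top (ENNReal.rpow_lt_top_of_nonneg (by positivity) ENNReal.ofReal_ne_top)
      hg.2

/-- **Translation of the local class**: a suitable weak solution in `Q(z, R)` translated by `z`
is a suitable weak solution in `Q(0, R)` (zoom to the unit ball and back, `zoom_zoom`). -/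
theorem isSuitableWeakSolutionInBall_translate {R : ℝ} {z : ℝ × (EuclideanSpace ℝ (Fin 3))} {u : ℝ → (EuclideanSpace ℝ (Fin 3)) → (EuclideanSpace ℝ (Fin 3))}
    {p : ℝ → (EuclideanSpace ℝ (Fin 3)) → ℝ} (h : IsSuitableWeakSolutionInBall R z u p) (hR : 0 < R) :
    IsSuitableWeakSolutionInBall R 0 (stPull (1 : ℝ) 1 z.1 z.2 u) (stPull (1 : ℝ) 1 z.1 z.2 p) := by
  have h1 := h.zoom hR
  have h2 := h1.zoomOut (c := R⁻¹) (inv_pos.2 hR)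
  rw [zoom_zoom, zoom_zoom, inv_mul_cancel₀ hR.ne', one_div, inv_inv,
    show R⁻¹ ^ 2 * R ^ 2 = (1 : ℝ) by rw [← mul_pow, inv_mul_cancel₀ hR.ne', one_pow],
    one_pow, one_smul, one_smul] at h2
  exact h2

/-- **Pressure pairings under the translation**: for `Q(z, R) ⊆ Q(0, a)`,
`∫_{Q(0,a)} π · 𝟙_{Q(z,R)} (g ∘ τ_{−z}) = ∫_{Q(0,R)} (π ∘ τ_z) · g`. -/
theorem setIntegral_translate_pressure_mul (z : ℝ × (EuclideanSpace ℝ (Fin 3))) {a R : ℝ}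
    (hsub : parabolicCylinder R z ⊆ parabolicCylinder a (0 : ℝ × (EuclideanSpace ℝ (Fin 3))))
    (π : ℝ → (EuclideanSpace ℝ (Fin 3)) → ℝ) (g : ℝ × (EuclideanSpace ℝ (Fin 3)) → ℝ) :
    ∫ w in parabolicCylinder a (0 : ℝ × (EuclideanSpace ℝ (Fin 3))),
        π w.1 w.2 * (parabolicCylinder R z).indicator (g ∘ stAffine (1 : ℝ) 1 (-z.1) (-z.2)) w =
      ∫ w in parabolicCylinder R (0 : ℝ × (EuclideanSpace ℝ (Fin 3))), (stPull (1 : ℝ) 1 z.1 z.2 π) w.1 w.2 * g w := by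
  have e1 : (fun w : ℝ × (EuclideanSpace ℝ (Fin 3)) => π w.1 w.2 *
      (parabolicCylinder R z).indicator (g ∘ stAffine (1 : ℝ) 1 (-z.1) (-z.2)) w) =
      (parabolicCylinder R z).indicator
        (fun w => π w.1 w.2 * (g ∘ stAffine (1 : ℝ) 1 (-z.1) (-z.2)) w) := by
    funext w
    rw [indicator_mul_right]
  rw [e1, setIntegral_indicator (isOpen_parabolicCylinder R z).measurableSet,
    inter_eq_right.2 hsub]
  have h := setIntegral_preimage_comp_stAffine (E := (EuclideanSpace ℝ (Fin 3))) one_pos one_pos z.1 z.2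
    (fun w : ℝ × (EuclideanSpace ℝ (Fin 3)) => π w.1 w.2 * (g ∘ stAffine (1 : ℝ) 1 (-z.1) (-z.2)) w) (parabolicCylinder R z)
  rw [stAffine_one_one_preimage_parabolicCylinder_self] at h
  simp only [finrank_euclideanSpace_fin, one_pow, mul_one, inv_one, one_smul,
    comp_apply, stAffine_fst, stAffine_snd, one_mul, stAffine_one_one_neg_apply] at h
  change (∫ x in parabolicCylinder R z, π x.1 x.2 * g (stAffine (1 : ℝ) 1 (-z.1) (-z.2) x)) = _
  rw [← h]
  refine setIntegral_congr_fun (isOpen_parabolicCylinder R _).measurableSet fun w _ => ?_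
  simp only [stPull_apply, one_mul, one_smul]

/-! ### Persistence of singularities at a translated vertex -/

/-- **Persistence of singularities at a point of the closed backward slab** (Albritton–Barker
2019, Prop. 2.3 = Rusin–Šverák 2011, Lemma 2.1; Barker–Prange 2020, Lemma 3 — the tree's PROVED
`PersistenceOfSingularities_holds`, transported by the unit-scale translation).  Let `(v_k, q_k)`
be suitable weak solutions in the balls `Q(0, 2ᵐ)`, `m ≤ k`, with uniform `L³ × L^{3/2}` bounds
at every level, and let `(u, p)` be a limit along `σ` in the sense of
`LocalTypeIBlowup.local_suitableCompactness` (class on every `Q(0, a)`, strong `L³` convergence of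
the velocities, weak convergence of the pressures).  If at a point `z` with `z.1 ≤ 0` the
approximants blow up in `L^∞(Q(z, R))` along `σ` for every `0 < R < 1`, then `z` is a backward
singular point of `u`. -/
theorem isBackwardSingularPoint_of_translated_persistence
    {v : ℕ → ℝ → (EuclideanSpace ℝ (Fin 3)) → (EuclideanSpace ℝ (Fin 3))} {q : ℕ → ℝ → (EuclideanSpace ℝ (Fin 3)) → ℝ}
    (hball : ∀ m k : ℕ, m ≤ k → IsSuitableWeakSolutionInBall ((2 : ℝ) ^ m) 0 (v k) (q k))
    (hbd : ∀ m : ℕ, (⨆ k, ⨆ (_ : m ≤ k), (eLpNorm (uncurry (v k)) 3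
        (volume.restrict (parabolicCylinder ((2 : ℝ) ^ m) (0 : ℝ × (EuclideanSpace ℝ (Fin 3))))) +
      eLpNorm (uncurry (q k)) (3 / 2)
        (volume.restrict (parabolicCylinder ((2 : ℝ) ^ m) (0 : ℝ × (EuclideanSpace ℝ (Fin 3))))))) < ∞)
    {u : ℝ → (EuclideanSpace ℝ (Fin 3)) → (EuclideanSpace ℝ (Fin 3))} {p : ℝ → (EuclideanSpace ℝ (Fin 3)) → ℝ} {σ : ℕ → ℕ} (hσ : StrictMono σ)
    (hlim : ∀ a : ℝ, 0 < a →
      IsSuitableWeakSolutionInBall a 0 u p ∧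
      MemLp (uncurry u) 3 (volume.restrict (parabolicCylinder a (0 : ℝ × (EuclideanSpace ℝ (Fin 3))))) ∧
      Tendsto (fun j => eLpNorm (uncurry (v (σ j)) - uncurry u) 3
        (volume.restrict (parabolicCylinder a (0 : ℝ × (EuclideanSpace ℝ (Fin 3)))))) atTop (𝓝 0) ∧
      ∀ g : ℝ × (EuclideanSpace ℝ (Fin 3)) → ℝ, MemLp g 3 (volume.restrict (parabolicCylinder a (0 : ℝ × (EuclideanSpace ℝ (Fin 3))))) →
        Tendsto (fun j => ∫ w in parabolicCylinder a (0 : ℝ × (EuclideanSpace ℝ (Fin 3))), q (σ j) w.1 w.2 * g w) atTop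
          (𝓝 (∫ w in parabolicCylinder a (0 : ℝ × (EuclideanSpace ℝ (Fin 3))), p w.1 w.2 * g w)))
    {z : ℝ × (EuclideanSpace ℝ (Fin 3))} (hz : z.1 ≤ 0)
    (hblow : ∀ R ∈ Ioo (0 : ℝ) 1, limsup (fun j => eLpNorm (uncurry (v (σ j))) ⊤
      (volume.restrict (parabolicCylinder R z))) atTop = ⊤) :
    IsBackwardSingularPoint u z := by
  have hcc_pos : ∀ m : ℕ, (0 : ℝ) < (2 : ℝ) ^ m := fun m => by positivity
  -- ## the level `m₀` with `Q(z, 1) ⊆ Q(0, 2^{m₀})`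
  obtain ⟨m₀, hm₀⟩ := pow_unbounded_of_one_lt (max (1 - z.1) (‖z.2‖ + 1) + 1) (by norm_num : (1 : ℝ) < 2)
  set a : ℝ := (2 : ℝ) ^ m₀ with ha
  have ha0 : 0 < a := hcc_pos m₀
  have ha1 : 1 ≤ a := one_le_pow₀ (by norm_num)
  have hsubR : ∀ R : ℝ, 0 < R → R ≤ 1 → parabolicCylinder R z ⊆ parabolicCylinder a (0 : ℝ × (EuclideanSpace ℝ (Fin 3))) := by
    intro R hR hR1 w hw
    rw [mem_parabolicCylinder] at hw ⊢
    simp only [Prod.fst_zero, Prod.snd_zero, zero_sub, dist_zero_right]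
    obtain ⟨⟨h1, h2⟩, h3⟩ := hw
    have hz1 : 1 - z.1 < a := by linarith [le_max_left (1 - z.1) (‖z.2‖ + 1)]
    have hz2 : ‖z.2‖ + 1 < a := by linarith [le_max_right (1 - z.1) (‖z.2‖ + 1)]
    have hR2 : R ^ 2 ≤ 1 := by nlinarith
    refine ⟨⟨?_, by linarith⟩, ?_⟩
    · nlinarith
    · calc ‖w.2‖ = ‖(w.2 - z.2) + z.2‖ := by rw [sub_add_cancel]
        _ ≤ ‖w.2 - z.2‖ + ‖z.2‖ := norm_add_le _ _
        _ < R + ‖z.2‖ := by rw [← dist_eq_norm]; linarith [h3]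
        _ ≤ a := by linarith
  have hsub1 : parabolicCylinder 1 z ⊆ parabolicCylinder a (0 : ℝ × (EuclideanSpace ℝ (Fin 3))) := hsubR 1 one_pos le_rfl
  -- ## the shifted subsequence and the translated data
  set σ' : ℕ → ℕ := fun j => σ (j + m₀) with hσ'
  have hσ'm : ∀ j, m₀ ≤ σ' j := fun j => (Nat.le_add_left m₀ j).trans (hσ.id_le (j + m₀))
  set w : ℕ → ℝ → (EuclideanSpace ℝ (Fin 3)) → (EuclideanSpace ℝ (Fin 3)) := fun j => stPull (1 : ℝ) 1 z.1 z.2 (v (σ' j)) with hw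
  set qw : ℕ → ℝ → (EuclideanSpace ℝ (Fin 3)) → ℝ := fun j => stPull (1 : ℝ) 1 z.1 z.2 (q (σ' j)) with hqw
  set uw : ℝ → (EuclideanSpace ℝ (Fin 3)) → (EuclideanSpace ℝ (Fin 3)) := stPull (1 : ℝ) 1 z.1 z.2 u with huw
  set pw : ℝ → (EuclideanSpace ℝ (Fin 3)) → ℝ := stPull (1 : ℝ) 1 z.1 z.2 p with hpw
  -- (P1) the class on `Q(0, 1)`
  have hone : ∀ j, IsSuitableWeakSolutionInBall 1 0 (w j) (qw j) := fun j =>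
    isSuitableWeakSolutionInBall_translate
      ((hball m₀ (σ' j) (hσ'm j)).of_subset_zero one_pos hsub1) one_pos
  -- (P2) the uniform `L³ × L^{3/2}` bound on `Q(0, 1)`
  have hbd1 : (⨆ j, eLpNorm (uncurry (w j)) 3 (volume.restrict (parabolicCylinder 1 (0 : ℝ × (EuclideanSpace ℝ (Fin 3))))) +
      eLpNorm (uncurry (qw j)) (3 / 2) (volume.restrict (parabolicCylinder 1 (0 : ℝ × (EuclideanSpace ℝ (Fin 3)))))) < ∞ := by
    refine lt_of_le_of_lt (iSup_le fun j => ?_) (hbd m₀)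
    have e1 : eLpNorm (uncurry (w j)) 3 (volume.restrict (parabolicCylinder 1 (0 : ℝ × (EuclideanSpace ℝ (Fin 3))))) =
        eLpNorm (uncurry (v (σ' j))) 3 (volume.restrict (parabolicCylinder 1 z)) := by
      rw [hw, uncurry_stPull]
      exact eLpNorm_comp_translate z 1 _ (by norm_num) (by norm_num)
    have e2 : eLpNorm (uncurry (qw j)) (3 / 2) (volume.restrict (parabolicCylinder 1 (0 : ℝ × (EuclideanSpace ℝ (Fin 3))))) =
        eLpNorm (uncurry (q (σ' j))) (3 / 2) (volume.restrict (parabolicCylinder 1 z)) := by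
      rw [hqw, uncurry_stPull]
      exact eLpNorm_comp_translate z 1 _ (by norm_num)
        (ENNReal.div_ne_top (by norm_num) (by norm_num))
    rw [e1, e2]
    refine le_trans (add_le_add (eLpNorm_mono_measure _ (Measure.restrict_mono hsub1 le_rfl))
      (eLpNorm_mono_measure _ (Measure.restrict_mono hsub1 le_rfl))) ?_
    exact le_iSup₂ (f := fun k (_ : m₀ ≤ k) => eLpNorm (uncurry (v k)) 3
        (volume.restrict (parabolicCylinder ((2 : ℝ) ^ m₀) (0 : ℝ × (EuclideanSpace ℝ (Fin 3))))) +
      eLpNorm (uncurry (q k)) (3 / 2)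
        (volume.restrict (parabolicCylinder ((2 : ℝ) ^ m₀) (0 : ℝ × (EuclideanSpace ℝ (Fin 3)))))) (σ' j) (hσ'm j)
  -- (P3) the convergences on `Q(0, R)`, `0 < R < 1`
  obtain ⟨hclass_a, -, hconv_a, hweak_a⟩ := hlim a ha0
  have hlimw : ∀ R ∈ Ioo (0 : ℝ) 1,
      IsSuitableWeakSolutionInBall R 0 uw pw ∧
      Tendsto (fun j => eLpNorm (uncurry (w j) - uncurry uw) 3
        (volume.restrict (parabolicCylinder R (0 : ℝ × (EuclideanSpace ℝ (Fin 3)))))) atTop (𝓝 0) ∧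
      ∀ g : ℝ × (EuclideanSpace ℝ (Fin 3)) → ℝ, MemLp g 3 (volume.restrict (parabolicCylinder R (0 : ℝ × (EuclideanSpace ℝ (Fin 3))))) →
        Tendsto (fun j => ∫ w' in parabolicCylinder R (0 : ℝ × (EuclideanSpace ℝ (Fin 3))), qw j w'.1 w'.2 * g w') atTop
          (𝓝 (∫ w' in parabolicCylinder R (0 : ℝ × (EuclideanSpace ℝ (Fin 3))), pw w'.1 w'.2 * g w')) := by
    intro R hR
    have hsubRz : parabolicCylinder R z ⊆ parabolicCylinder a (0 : ℝ × (EuclideanSpace ℝ (Fin 3))) := hsubR R hR.1 hR.2.le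
    refine ⟨isSuitableWeakSolutionInBall_translate (hclass_a.of_subset_zero hR.1 hsubRz) hR.1, ?_, ?_⟩
    · -- strong convergence: the translated norms are norms on `Q(z, R) ⊆ Q(0, a)`
      have e : ∀ j, eLpNorm (uncurry (w j) - uncurry uw) 3
          (volume.restrict (parabolicCylinder R (0 : ℝ × (EuclideanSpace ℝ (Fin 3))))) =
          eLpNorm (uncurry (v (σ' j)) - uncurry u) 3 (volume.restrict (parabolicCylinder R z)) := by
        intro j
        rw [hw, huw, uncurry_stPull, uncurry_stPull, ← eLpNorm_comp_translate z R _ (by norm_num)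
          (by norm_num)]
        rfl
      simp only [e]
      have h2 : Tendsto (fun j => eLpNorm (uncurry (v (σ' j)) - uncurry u) 3
          (volume.restrict (parabolicCylinder a (0 : ℝ × (EuclideanSpace ℝ (Fin 3)))))) atTop (𝓝 0) :=
        hconv_a.comp (tendsto_add_atTop_nat m₀)
      exact tendsto_of_tendsto_of_tendsto_of_le_of_le tendsto_const_nhds h2 (fun _ => zero_le)
        fun j => eLpNorm_mono_measure _ (Measure.restrict_mono hsubRz le_rfl)
    · -- weak convergence of the pressures: transport the test function to `Q(0, a)`
      intro g hg
      set gt : ℝ × (EuclideanSpace ℝ (Fin 3)) → ℝ :=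
        (parabolicCylinder R z).indicator (g ∘ stAffine (1 : ℝ) 1 (-z.1) (-z.2)) with hgt
      have hgt3 : MemLp gt 3 (volume.restrict (parabolicCylinder a (0 : ℝ × (EuclideanSpace ℝ (Fin 3))))) := by
        rw [hgt, memLp_indicator_iff_restrict (isOpen_parabolicCylinder R z).measurableSet,
          Measure.restrict_restrict (isOpen_parabolicCylinder R z).measurableSet,
          inter_eq_left.2 hsubRz, ← stAffine_one_one_neg_preimage_parabolicCylinder z R]
        exact memLp_comp_translate (-z.1) (-z.2) (by norm_num) (by norm_num) hg
      have h5 := (hweak_a gt hgt3).comp (tendsto_add_atTop_nat m₀)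
      have key : ∀ π : ℝ → (EuclideanSpace ℝ (Fin 3)) → ℝ,
          ∫ w' in parabolicCylinder a (0 : ℝ × (EuclideanSpace ℝ (Fin 3))), π w'.1 w'.2 * gt w' =
            ∫ w' in parabolicCylinder R (0 : ℝ × (EuclideanSpace ℝ (Fin 3))), (stPull (1 : ℝ) 1 z.1 z.2 π) w'.1 w'.2 * g w' :=
        fun π => setIntegral_translate_pressure_mul z hsubRz π g
      simp only [key] at h5
      exact h5
  -- (P4) blow-up of the translated approximants on every `Q(0, R)`
  have hbloww : ∀ R ∈ Ioo (0 : ℝ) 1, limsup (fun j => eLpNorm (uncurry (w j)) ⊤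
      (volume.restrict (parabolicCylinder R (0 : ℝ × (EuclideanSpace ℝ (Fin 3)))))) atTop = ⊤ := by
    intro R hR
    have e : (fun j => eLpNorm (uncurry (w j)) ⊤ (volume.restrict (parabolicCylinder R (0 : ℝ × (EuclideanSpace ℝ (Fin 3)))))) =
        fun j => eLpNorm (uncurry (v (σ (j + m₀)))) ⊤ (volume.restrict (parabolicCylinder R z)) := by
      funext j
      exact eLpNorm_top_translate z R (v (σ' j))
    rw [e]
    exact (Filter.limsup_nat_add
      (fun i => eLpNorm (uncurry (v (σ i))) ⊤ (volume.restrict (parabolicCylinder R z))) m₀).trans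
      (hblow R hR)
  -- ## persistence on `Q(0, 1)` and translation back
  have hsing0 : IsBackwardSingularPoint uw 0 :=
    PersistenceOfSingularities_holds w qw uw pw hone hbd1 hlimw hbloww
  intro r hr
  rw [← eLpNorm_top_translate z r u]
  exact hsing0 r hr

end Summit.NavierStokesRegularity.NavierStokesRegularity.Cruxes.ScarEnvelopeTypeI.ScarZoom

end
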